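import Mathlib
import Summits.ValiantsHypothesis.ValiantsHypothesis.Theorems.ValuativeGCTValuativeFlipStrataRankR

/-!
# Sharp per-stratum rank bound, Right-multiplied strata: `4n - 20 ≤ rank` (crux `ValuativeGCT.ValuativeFlip`)

Wall-breaker axis P-explicit (explicit per-side constructions) for crux `ValuativeGCT.ValuativeFlip`
(stmt-ValiantsHypothesis-12624), line `four-row-count`.  The landed P4-SIMPLE bound
`sr_finrank_span_ge` (`4n - 2(k+2)`, file `…StrataRankR`) loses `2k` dimensions per stratum, which is
why the cyclic-tridiagonal certificate (`cyc_finrank_tanV_ge`, `((n-4)/2)(6n-6) ≈ 3n²`) reaches the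
head of the window only up to slope `6/5` (any slope `< √(3/2)`).  Here the loss is a CONSTANT:

* `sr_finrank_span_ge_sharp` — for injective `α γ : ZMod n → K`, `n = e + k + 1`, `3 ≤ e`, `2 ≤ k`,
  the `4n` bottoms `P_{q+2o} · y_{2+t} · R_q` of the Right-multiplied stratum span at least `4n - 20`
  dimensions.

Proof (block-triangular evaluation, new).  Group the generators by their Left window: the weights
attached to `P_q` are `c (q,0,·)` and `c (q-2,1,·)`.  A relation with the five groups
`q = 0,…,4` switched off is trivial, by downward induction on `q = n-1, …, 5` (`sr_step`): substitute
`y₂ ↦ γ_v` (`srEv`, landed) and then `y₀ ↦ α_{q-1}` — this kills `P_{q'}` for the `e` groups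
`q' ∈ [q-e, q-1]` just below `q`, while for the far groups `q' ∈ [5, q-e-1]` the four points
`v ∈ {q, q+1, q+2, q+3}` are common roots of `R_{q'}` and `R_{q'-2}`, so their coefficient `srW c q' v`
vanishes identically; the groups above `q` vanish by induction.  Hence `srW c q v = 0` at those four
points; together with the `k - 2` common roots of `R_q, R_{q-2}` the polynomial `srPoly c q` (degree
`≤ k + 1`) has `k + 2` roots, so it is zero and the landed coefficient extraction
`sr_coeff_eq_zero_of_srPoly_eq_zero` switches group `q` off.  So the kernel of the coefficient map
embeds into the `20` switched-off coordinates.  (Numerically the stratum rank is `4n - 7`; `4n - 20`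
is what the head of the window at every slope `< √2` needs.) [this crux; new]
-/

set_option linter.dupNamespace false

namespace Summit.ValiantsHypothesis.ValiantsHypothesis.Theorems.ValuativeFlip

open MvPolynomial
open scoped BigOperators

noncomputable section

section lemmas

variable {K : Type*} [Field K] {n : ℕ}

/-- Casting naturals below `n` into `ZMod n` is injective (local copy). [folklore] -/
private theorem srs_natCast_inj {s t : ℕ} (hs : s < n) (ht : t < n)
    (h : (s : ZMod n) = (t : ZMod n)) : s = t := by
  have := congrArg ZMod.val h
  rwa [ZMod.val_cast_of_lt hs, ZMod.val_cast_of_lt ht] at this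

/-- A switched-off group contributes nothing to the coefficient of `P_q`. [this crux] -/
theorem srW_eq_zero_of_groupZero (γ : ZMod n → K) (e k : ℕ) {c : ZMod n × Fin 2 × Fin 2 → K}
    {q : ZMod n}
    (h : (c (q, 0, 0) = 0 ∧ c (q, 0, 1) = 0 ∧ c (q - 2, 1, 0) = 0 ∧ c (q - 2, 1, 1) = 0)) (v : ZMod n) : srW γ e k c q v = 0 := by
  obtain ⟨h1, h2, h3, h4⟩ := h
  simp [srW, Fin.sum_univ_two, h1, h2, h3, h4]

/-- The value of `R_q` at `γ_v` vanishes when `v = q + (e+1) + s`, `s < k` (a root of the window).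
[this crux] -/
theorem srRVal_eq_zero_of_eq (γ : ZMod n → K) (e k : ℕ) (q v : ZMod n) {s : ℕ} (hs : s < k)
    (hv : v = q + ((e + 1 : ℕ) : ZMod n) + (s : ZMod n)) : srRVal γ e k q v = 0 := by
  unfold srRVal
  exact Finset.prod_eq_zero (Finset.mem_range.mpr hs) (by rw [hv, sub_self])

/-- **Common roots.**  At `v = q + (e+1) + s` with `s + 2 < k` both `R_q` and `R_{q-2}` vanish, so the
coefficient `srW c q v` of `P_q` vanishes whatever the weights are. [this crux] -/
theorem srW_eq_zero_of_common_root (γ : ZMod n → K) (e k : ℕ) (c : ZMod n × Fin 2 × Fin 2 → K)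
    (q v : ZMod n) {s : ℕ} (hs : s + 2 < k)
    (hv : v = q + ((e + 1 : ℕ) : ZMod n) + (s : ZMod n)) : srW γ e k c q v = 0 := by
  unfold srW
  have h1 : srRVal γ e k q v = 0 := srRVal_eq_zero_of_eq γ e k q v (by omega) hv
  have h2 : srRVal γ e k (q - 2) v = 0 := by
    refine srRVal_eq_zero_of_eq γ e k (q - 2) v hs ?_
    rw [hv]
    push_cast
    ring
  rw [h1, h2, mul_zero, mul_zero, add_zero]

/-- **The inductive step.**  If the relation `Σ_q srW c q v • P_q = 0` holds for every `v`, and the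
groups strictly above `u` and the groups `0,…,4` are switched off, then group `u` (`u < n`) is
switched off.  Needs `α, γ` injective, `n = e + k + 1`, `3 ≤ e`, `2 ≤ k`. [this crux; new] -/
theorem sr_step [NeZero n] {α γ : ZMod n → K} (hα : Function.Injective α)
    (hγ : Function.Injective γ) {e k : ℕ} (hn : n = e + k + 1) (he : 3 ≤ e) (hk : 2 ≤ k)
    (c : ZMod n × Fin 2 × Fin 2 → K)
    (hrel : ∀ v : ZMod n, ∑ q : ZMod n, srW γ e k c q v • swW α (0 : Fin 4) 1 e q = 0)
    {u : ℕ} (hun : u < n)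
    (hzero : ∀ u' : ℕ, u' < n → (u < u' ∨ u' ≤ 4) →
      (c ((u' : ZMod n), 0, 0) = 0 ∧ c ((u' : ZMod n), 0, 1) = 0 ∧ c ((u' : ZMod n) - 2, 1, 0) = 0 ∧ c ((u' : ZMod n) - 2, 1, 1) = 0)) :
    (c ((u : ZMod n), 0, 0) = 0 ∧ c ((u : ZMod n), 0, 1) = 0 ∧ c ((u : ZMod n) - 2, 1, 0) = 0 ∧ c ((u : ZMod n) - 2, 1, 1) = 0) := by
  have h01 : (0 : Fin 4) ≠ 1 := by decide
  -- Step 1: the four new roots `v = u + i`, `i < 4`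
  have hval : ∀ i : ℕ, i < 4 → srW γ e k c (u : ZMod n) ((u : ZMod n) + (i : ZMod n)) = 0 := by
    intro i hi
    have h := congrArg (MvPolynomial.eval (swPt (0 : Fin 4) (α ((u : ZMod n) - 1))))
      (hrel ((u : ZMod n) + (i : ZMod n)))
    rw [map_sum, map_zero, Finset.sum_eq_single (u : ZMod n)] at h
    · rw [smul_eval] at h
      exact (mul_eq_zero.mp h).resolve_right (sw_eval_pt_ne_zero hα h01 (by omega) _)
    · intro q _ hq
      rw [smul_eval]
      obtain ⟨u', hu'n, rfl⟩ : ∃ u' : ℕ, u' < n ∧ q = (u' : ZMod n) :=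
        ⟨q.val, ZMod.val_lt q, (ZMod.natCast_zmod_val q).symm⟩
      have hne : u' ≠ u := by
        intro h'
        exact hq (by rw [h'])
      rcases (show (u < u' ∨ u' ≤ 4) ∨ (u' < u ∧ 5 ≤ u') by omega) with hA | ⟨hlt, h5⟩
      · rw [srW_eq_zero_of_groupZero γ e k (hzero u' hu'n hA), zero_mul]
      · rcases Nat.lt_or_ge (u' + e) u with hfar | hnear
        · -- far group: `u + i` is a common root of `R_{u'}` and `R_{u'-2}`
          obtain ⟨s, hs1, hs2⟩ : ∃ s : ℕ, u + i = u' + (e + 1) + s ∧ s + 2 < k :=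
            ⟨u + i - u' - (e + 1), by omega, by omega⟩
          rw [srW_eq_zero_of_common_root γ e k c _ _ hs2 ?_, zero_mul]
          have hc : ((u : ZMod n) + (i : ZMod n)) = ((u' + (e + 1) + s : ℕ) : ZMod n) := by
            rw [← Nat.cast_add, hs1]
          rw [hc]
          push_cast
          ring
        · -- near group: `P_{u'}` vanishes at `α_{u-1}`
          obtain ⟨d, hd1, hd2⟩ : ∃ d : ℕ, u = u' + d + 1 ∧ d < e := ⟨u - 1 - u', by omega, by omega⟩
          rw [sw_eval_pt_eq_zero α h01 ((u' : ℕ) : ZMod n) ((u : ZMod n) - 1) hd2 ?_, mul_zero]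
          rw [hd1]
          push_cast
          ring
    · intro h'
      exact absurd (Finset.mem_univ _) h'
  -- Step 2: the `k - 2` common roots of `R_u` and `R_{u-2}`
  have hcommon : ∀ s : ℕ, s + 2 < k →
      srW γ e k c (u : ZMod n) ((u : ZMod n) + ((e + 1 + s : ℕ) : ZMod n)) = 0 := by
    intro s hs
    refine srW_eq_zero_of_common_root γ e k c _ _ hs ?_
    push_cast
    ring
  -- Step 3: `srPoly c u` has `k + 2` distinct roots
  let off : Fin (k + 2) → ℕ := fun j => if (j : ℕ) < 4 then (j : ℕ) else e + 1 + ((j : ℕ) - 4)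
  have hoff_lt : ∀ j, off j < n := by
    intro j
    have hj := j.isLt
    simp only [off]
    split_ifs <;> omega
  have hoff_inj : ∀ j j' : Fin (k + 2), off j = off j' → j = j' := by
    intro j j' h
    apply Fin.ext
    simp only [off] at h
    split_ifs at h <;> omega
  let pts : Fin (k + 2) → K := fun j => γ ((u : ZMod n) + ((off j : ℕ) : ZMod n))
  have hpts : Function.Injective pts := by
    intro j j' h
    have h1 : (u : ZMod n) + ((off j : ℕ) : ZMod n) = (u : ZMod n) + ((off j' : ℕ) : ZMod n) := hγ h
    exact hoff_inj j j' (srs_natCast_inj (hoff_lt j) (hoff_lt j') (add_left_cancel h1))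
  have hroots : ∀ j, (srPoly γ e k c (u : ZMod n)).eval (pts j) = 0 := by
    intro j
    have hj := j.isLt
    change (srPoly γ e k c (u : ZMod n)).eval (γ ((u : ZMod n) + ((off j : ℕ) : ZMod n))) = 0
    rw [eval_srPoly]
    by_cases hj4 : (j : ℕ) < 4
    · simp only [off, if_pos hj4]
      exact hval j hj4
    · simp only [off, if_neg hj4]
      exact hcommon ((j : ℕ) - 4) (by omega)
  have hpoly : srPoly γ e k c (u : ZMod n) = 0 :=
    Polynomial.eq_zero_of_natDegree_lt_card_of_eval_eq_zero _ hpts hroots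
      (by simpa only [Fintype.card_fin] using Nat.lt_succ_of_le (natDegree_srPoly_le γ e k c _))
  exact sr_coeff_eq_zero_of_srPoly_eq_zero hγ hn (by omega) hk c _ hpoly

/-- **All groups vanish** once the groups `0, …, 4` are switched off (downward induction on the
group index with `sr_step`). [this crux; new] -/
theorem sr_allGroups_zero [NeZero n] {α γ : ZMod n → K} (hα : Function.Injective α)
    (hγ : Function.Injective γ) {e k : ℕ} (hn : n = e + k + 1) (he : 3 ≤ e) (hk : 2 ≤ k)
    (c : ZMod n × Fin 2 × Fin 2 → K)
    (hrel : ∀ v : ZMod n, ∑ q : ZMod n, srW γ e k c q v • swW α (0 : Fin 4) 1 e q = 0)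
    (hbase : ∀ u : ℕ, u ≤ 4 →
      (c ((u : ZMod n), 0, 0) = 0 ∧ c ((u : ZMod n), 0, 1) = 0 ∧ c ((u : ZMod n) - 2, 1, 0) = 0 ∧ c ((u : ZMod n) - 2, 1, 1) = 0)) :
    ∀ u : ℕ, u < n →
      (c ((u : ZMod n), 0, 0) = 0 ∧ c ((u : ZMod n), 0, 1) = 0 ∧ c ((u : ZMod n) - 2, 1, 0) = 0 ∧ c ((u : ZMod n) - 2, 1, 1) = 0) := by
  suffices h : ∀ d u : ℕ, u + d + 1 = n →
      (c ((u : ZMod n), 0, 0) = 0 ∧ c ((u : ZMod n), 0, 1) = 0 ∧ c ((u : ZMod n) - 2, 1, 0) = 0 ∧ c ((u : ZMod n) - 2, 1, 1) = 0) by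
    intro u hu
    exact h (n - 1 - u) u (by omega)
  intro d
  induction' d using Nat.strong_induction_on with d ih
  intro u hud
  by_cases hu4 : u ≤ 4
  · exact hbase u hu4
  · refine sr_step hα hγ hn he hk c hrel (by omega) ?_
    intro u' hu'n hcase
    rcases hcase with hlt | hle
    · exact ih (n - 1 - u') (by omega) u' (by omega)
    · exact hbase u' hle

end lemmas

/-- **P4 SHARP, Right side.**  For injective `α γ : ZMod n → K`, `n = e + k + 1`, `3 ≤ e`, `2 ≤ k`:
the `4n` products `P_{q+2o} · y_{2+t} · R_q` span at least `4n - 20` dimensions (the kernel of the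
coefficient map embeds into the `20` weights of the groups `0, …, 4`). [this crux; new] -/
theorem sr_finrank_span_ge_sharp {K : Type*} [Field K] {n : ℕ} [NeZero n] {α γ : ZMod n → K}
    (hα : Function.Injective α) (hγ : Function.Injective γ) {e k : ℕ} (hn : n = e + k + 1)
    (he : 3 ≤ e) (hk : 2 ≤ k) :
    4 * n - 20 ≤ Module.finrank K ↥(Submodule.span K (Set.range (srGen α γ e k))) := by
  classical
  set Ψ := Fintype.linearCombination K (srGen α γ e k) with hΨ
  have hrange : LinearMap.range Ψ = Submodule.span K (Set.range (srGen α γ e k)) :=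
    Fintype.range_linearCombination K _
  -- the recording map on the kernel: the weights of the groups `0, …, 4`
  let Θ : (LinearMap.ker Ψ) →ₗ[K] (Fin 5 × Fin 2 × Fin 2 → K) :=
    { toFun := fun c j => if j.2.1 = 0 then
          (c : ZMod n × Fin 2 × Fin 2 → K) (((j.1 : ℕ) : ZMod n), 0, j.2.2)
        else (c : ZMod n × Fin 2 × Fin 2 → K) (((j.1 : ℕ) : ZMod n) - 2, 1, j.2.2)
      map_add' := by
        intro c d; funext j
        simp only [Submodule.coe_add, Pi.add_apply]
        split_ifs <;> rfl
      map_smul' := by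
        intro r c; funext j
        simp only [Submodule.coe_smul, Pi.smul_apply, smul_eq_mul, RingHom.id_apply]
        split_ifs <;> rfl }
  have hΘ : Function.Injective Θ := by
    rw [← LinearMap.ker_eq_bot, LinearMap.ker_eq_bot']
    intro c hc
    obtain ⟨c, hcker⟩ := c
    have hrel : Ψ c = 0 := hcker
    have hrelP : ∀ v : ZMod n, ∑ q : ZMod n, srW γ e k c q v • swW α (0 : Fin 4) 1 e q = 0 := by
      intro v
      rw [← srEv_linearCombination α γ e k v c]
      change srEv γ v (Ψ c) = 0
      rw [hrel, map_zero]
    have hbase : ∀ u : ℕ, u ≤ 4 →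
        (c ((u : ZMod n), 0, 0) = 0 ∧ c ((u : ZMod n), 0, 1) = 0 ∧ c ((u : ZMod n) - 2, 1, 0) = 0 ∧ c ((u : ZMod n) - 2, 1, 1) = 0) := by
      intro u hu
      have h0 : ∀ t : Fin 2, c ((u : ZMod n), 0, t) = 0 := by
        intro t
        have := congrFun hc ((⟨u, by omega⟩ : Fin 5), 0, t)
        simpa [Θ] using this
      have h1 : ∀ t : Fin 2, c ((u : ZMod n) - 2, 1, t) = 0 := by
        intro t
        have := congrFun hc ((⟨u, by omega⟩ : Fin 5), 1, t)
        simpa [Θ] using this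
      exact ⟨h0 0, h0 1, h1 0, h1 1⟩
    have hall := sr_allGroups_zero hα hγ hn he hk c hrelP hbase
    apply Subtype.ext
    funext ⟨q, o, t⟩
    simp only [Submodule.coe_zero, Pi.zero_apply]
    fin_cases o
    · have h := hall q.val (ZMod.val_lt q)
      simp only [ZMod.natCast_zmod_val] at h
      fin_cases t
      · exact h.1
      · exact h.2.1
    · have h := hall (q + 2).val (ZMod.val_lt _)
      simp only [ZMod.natCast_zmod_val] at h
      obtain ⟨-, -, h3, h4⟩ := h
      simp only [add_sub_cancel_right] at h3 h4
      fin_cases t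
      · exact h3
      · exact h4
  -- dimension count
  have hker : Module.finrank K (LinearMap.ker Ψ) ≤ 20 := by
    have := LinearMap.finrank_le_finrank_of_injective hΘ
    rw [Module.finrank_fintype_fun_eq_card, Fintype.card_prod, Fintype.card_prod, Fintype.card_fin,
      Fintype.card_fin] at this
    linarith
  have hrn := LinearMap.finrank_range_add_finrank_ker Ψ
  rw [Module.finrank_fintype_fun_eq_card, Fintype.card_prod, Fintype.card_prod, ZMod.card,
    Fintype.card_fin] at hrn
  rw [← hrange]
  omega

end

end Summit.ValiantsHypothesis.ValiantsHypothesis.Theorems.ValuativeFlip
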